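import Summits.AtomisticToContinuum.BoseEinsteinCondensation.Theses.BECInsertionCorrector
import Summits.AtomisticToContinuum.BoseEinsteinCondensation.Theorems.StaticResponseBound.Negative.Basic
import Summits.AtomisticToContinuum.BoseEinsteinCondensation.Theorems.BECInsertionCorrectorStaticResponseBoundEcsfOfHyperuniformity
import Summits.AtomisticToContinuum.BoseEinsteinCondensation.Theorems.BECInsertionCorrectorStaticResponseBoundSectorDecomposition
import Summits.AtomisticToContinuum.BoseEinsteinCondensation.Theorems.BECInsertionCorrectorStaticResponseBoundSectorCauchySchwarz
import Summits.AtomisticToContinuum.BoseEinsteinCondensation.Theorems.BECInsertionCorrectorStaticResponseBoundWindowAssembly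
import Summits.AtomisticToContinuum.BoseEinsteinCondensation.Theorems.BECInsertionCorrectorStaticResponseBoundKineticBranchOfUv
import Summits.AtomisticToContinuum.BoseEinsteinCondensation.Theorems.BECInsertionCorrectorStaticResponseBoundSectorFloorToLandau
import Summits.AtomisticToContinuum.BoseEinsteinCondensation.Theorems.BECInsertionCorrectorStaticResponseBoundSectorFloorToHMinusOne
import Summits.AtomisticToContinuum.BoseEinsteinCondensation.Theorems.BECInsertionCorrectorStaticResponseBoundEnergyFloorToPoincareFloor
import Summits.AtomisticToContinuum.BoseEinsteinCondensation.Theorems.BECInsertionCorrectorStaticResponseBoundGroundStateDiscriminant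
import Summits.AtomisticToContinuum.BoseEinsteinCondensation.Theorems.BECInsertionCorrectorStaticResponseBoundResponseToHyperuniformity
import Summits.AtomisticToContinuum.BoseEinsteinCondensation.Theorems.BECInsertionCorrectorStaticResponseBoundFloorToHyperuniformity
import Summits.AtomisticToContinuum.BoseEinsteinCondensation.Theses.BECSectorPoincareTwoScale
import Literature.MathematicalPhysics.QuantumManyBody.BoseGasStructureFactor
import Literature.MathematicalPhysics.QuantumManyBody.PeriodicBoseGasMomentumSector
import Literature.MathematicalPhysics.QuantumManyBody.PeriodicFormDomain
import Literature.MathematicalPhysics.QuantumManyBody.WeightedCorrector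
import Literature.MathematicalPhysics.QuantumManyBody.PeriodicBoseGasScatteringODE
import Literature.MathematicalPhysics.QuantumManyBody.GroundStateDirichletForm
import HarnessLib.Audit

/-!
# Line `stable-fraction-square-completion` — crux `StaticResponseBound` (stmt-AtomisticToContinuum-12057)

Lead skeleton v6 (lead -2, after wave 1): the four bricks B1–B4 LANDED (B1 p98114+p99868 `Theorems/…SectorFloorToHMinusOne{Part1,}.lean`,
B4 p97465 `…EnergyFloorToPoincareFloor.lean`, B3 p97054 `…GroundStateDiscriminant.lean`, B2 p97762 `…ResponseToHyperuniformity.lean`) and are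
imported: the compositions H `floorSourced_hMinusOne` and K `hyperuniformity_of_staticResponseBound` are now KERNEL THEOREMS modulo nothing but their
named hypothesis (9091 resp. the crux), and the Feynman–Bijl calibration `hyperuniformity_of_sectorFloor` (p101763, `…FloorToHyperuniformity.lean`:
SectorFloor ⟹ the 9093-body for exact minimisers, ALL N) is imported; sorries = the five cores/debts of v4 again.

Lead skeleton v5 (lead prover-line-stmt-AtomisticToContinuum-12057-2, third lead, 2026-08-16): v4 UNCHANGED (the composition
`StaticResponseBound_proof` and its five registered stubs ECSF / SectorFloor / S5 / F1 / MaxFormBound, see below) PLUS the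
brick section `### Calibration II` at the end, which registers the four bricks B1–B4 of the planner's brick library
`Lines/fsum-sector-sandwich.lean` (verdict no-skeleton; triage r1: merge-absorb into this line) as stubs and carries its two
sorry-free compositions: H `floorSourced_hMinusOne` (LandauSectorBound stmt-9091 BY NAME ⟹ the `hMinusOneSqW` datum of
StaticResponseToHMinusOne / CorrectorClosure on the IR window — the route bypass) and K `hyperuniformity_of_staticResponseBound`
(the crux BY NAME ⟹ hyperuniformity of exact minimisers for ALL `N` — the kill-edge).

Lead skeleton v4 (lead prover-line-stmt-AtomisticToContinuum-12057-1, 2026-08-16, after wave 1 + drefute g4), built on the planner's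
checked skeleton `Lines/stable-fraction-square-completion.lean` (triage r1: pass ×3).

**Crux** (routes BECInsertionCorrector rank 2 / BECBathMassLiouville rank 3, verbatim identical —
`Negative.staticResponseBound_routes_agree`): for every repulsive finite-range `v` there are `ρ₀, C > 0` with
`E₀ − C t² N / max(ρa, |p|²) ≤ ⟨Ψ, HΨ⟩ + t ⟨∑ⱼ cos(p·xⱼ)⟩_Ψ` for all `ρ < ρ₀`, ALL `N`, all `k ≠ 0`
(`p = 2πk/L`, `L = (N/ρ)^{1/3}`), all `t` and every finite-energy periodic `Ψ`; equivalently
(`Negative.forall_ineq_iff_discriminant`) the all-states susceptibility bound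
`⟨∑cos⟩_Ψ² ≤ 4CN(E_Ψ − E₀)/max(ρa,|p|²)`.

**Lever.** Borrow the fraction `θ < 1` of the Bogoliubov vertex `g_p = 8πa + |p|²/(2ρ)` as a single-mode
mean-field ATTRACTION `−(θ g_p/L³)(|ρ̂_p|² − N)` (a bounded two-body multiplication operator; hard cores
allowed, no Fourier transform of `v`).  Stability + hyperuniformity of that SOFTENED functional at the one
mode `p` (stub A) is, after one application of the variational principle (stub C1), the ENERGY-CONTROLLED
STRUCTURE FACTOR `(θg_p/L³)‖ρ̂_pΦ‖² ≤ ⟨Φ,(H−E₀)Φ⟩ + θρg_p C_H |p|/√(ρa) ‖Φ‖²` for EVERY finite-energy state `Φ`;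
the centre-of-mass (Bloch) sector decomposition of a periodic `C¹` state with Parseval for the norm, the energy
form (hard cores included) and the `ρ̂_p` pairing (stub C2α), Cauchy–Schwarz over the sector pairs `(q, q+p)` with
the sector floor (stub B) on the stiffer member (stub C2β), and the discriminant in `t` (stub C3) give the crux on
the whole phonon + crossover branch `|p| ≤ M₀√(ρa)` with `C = 2(1+K₀)/θ`, `K₀ = 2θ(8π+M₀²/2)C_H/θ_L`.  The kinetic
branch `|p| > M₀√(ρa)` is NOT claimed by this line (stub D is the registered interface to the sibling line
`uv-thomson-force-wave`, whose kernel-checked `kineticBranch_of` delivers it modulo its own registered stubs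
`stub_uvForceWaveBound` (S5, crux-sized, promote-stub filed by the first lead), `stub_modulatedMinimiserExists` (F1)
and `stub_maxFormBound`).

**Status after wave 1 (skeleton v4).**  Registered stubs (statements written out in tree vocabulary —
Literature defs + the landed `Theorems/StaticResponseBound/Negative/Basic.lean` (`psq`, `cosMean`, `Ineq`) — so that a
stub file under `Theorems/` states exactly the registered text; the readable `def`s below are definitionally equal):
* ECSF `stub_energyControlledStructureFactor` (lead; XL, CRUX-SIZED, OPEN) — replaces the planner's stub A
  (`SoftenedModeHyperuniformity`), to which it is kernel-equivalent: A ⟹ ECSF = C1 (p81508), ECSF ⟹ A = drefute g4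
  (p83834, `Negative/SoftenedModeHyperuniformityOfEcsf.lean`).
* B  `stub_sectorFloor` (XL, CRUX-SIZED, OPEN; = LandauSectorBound stmt-9091 for ALL `N` at exact density + the far
  floor `θ_L M₀ ρa` off the window; worker analysis `SectorFloor-analysis.md` on the item: no false corner, B(2M₀) ⟹ 9091(M₀)).
* C1 `stub_ecsf_of_hyperuniformity` — LANDED p81508 (`Theorems/…EcsfOfHyperuniformity.lean`).
* C2α `stub_sectorDecomposition` — LANDED p85983 (+ p85000 `…SectorDecompositionFibre.lean`, p85013
  `…SectorDecompositionMeasure.lean`; `Theorems/…SectorDecomposition.lean`): Bloch/centre-of-mass components of a periodic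
  `C¹` state, Parseval for norm / energy form incl. hard cores / `ρ̂_p`-pairing.
* C2β `stub_sectorCauchySchwarz` — LANDED p87427 (`Theorems/…SectorCauchySchwarz.lean`).
* C3 `stub_windowAssembly` — LANDED p87701 (`Theorems/…WindowAssembly.lean`).
* D  `stub_kineticBranch` — GLUE since v3: the landed `kineticBranch_of_uvStubs` (p87668, `Theorems/…KineticBranchOfUv.lean`)
  on the three re-registered stubs of the sibling line `uv-thomson-force-wave`: `stub_maxFormBound` (classical, XL: capacity /
  spectral synthesis for wild admissible `v`), `stub_modulatedMinimiserExists` (F1, classical, XL: Perron–Frobenius + `C¹`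
  regularity on the torus), `stub_uvForceWaveBound` (S5, CRUX-SIZED, OPEN; promote-stub by lead -0).
Hence: `StaticResponseBound ⟸ ECSF ∧ SectorFloor ∧ S5 ∧ F1 ∧ MaxFormBound` is kernel-checked
(`StaticResponseBound_proof`, axioms of the glue `propext/Classical.choice/Quot.sound`); the IR half
`StaticResponseBoundPhonon ⟸ ECSF ∧ SectorFloor` is the sorry-free `phonon_of_ecsf_of_sectorFloor`.

**Disproof.lean used** (Cruxes/StaticResponseBound/Disproof.lean, gen 2, re-read 2026-08-16T04:10Z) + landed
`Theorems/StaticResponseBound/Negative/*.lean`: §A (`Body`/`Ineq`/discriminant — imported, used by name in C3 and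
`_of`), §B `not_staticResponseBoundAnyK` (`k ≠ 0` kept in A, C1, C2β, C3, D; used in C3: `p ≠ 0` separates the
sectors and makes `Δ > 0`), §E `not_staticResponseBoundWithoutFiniteEnergy` (finite-energy guard kept in A
(`IsSoftenedNearMin`), C1, C2β, C3, D; every `toReal` runs on finite-energy states), §C tightness `C ≥ 1/2`
(`C = 2(1+K₀)/θ`; A forces `θ ≤ 1`-ish so `C ≥ 2`), §G (`ineq_N_zero` in `_of`), Learning 4 (θ existential, meant
small), Learning 5 (window algebra: the sectors `q = 0`, `q = −p` are covered because the stiffer member of the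
pair is `±p` itself), §H (no charge/corrector functions: every integrand is continuous).  `## Targets`: none
registered at gen 2.  No landed `Negative/*` lemma negates a sector floor, a structure-factor bound or a
regime-restricted body (Negative/UvThomson* concern the sibling's stubs).
-/

namespace Summit.AtomisticToContinuum.BoseEinsteinCondensation.Cruxes.StaticResponseBound.StableFractionSquareCompletion

open MeasureTheory UnitAddTorus
open scoped ENNReal NNReal ComplexConjugate InnerProductSpace
open Literature.MathematicalPhysics.QuantumManyBody.BoseGas
open Summit.AtomisticToContinuum.BoseEinsteinCondensation.Theses
open Summit.AtomisticToContinuum.BoseEinsteinCondensation.Theorems.StaticResponseBound.Negative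
  (psq cosMean Ineq Body staticResponseBound_iff ineq_N_zero)

noncomputable section

-- The measure on `ℝ/ℤ` is the Haar PROBABILITY measure, as in `PeriodicFormDomain.lean`, the landed
-- `Theorems/…TruncationCompactness.lean` and `Theorems/…KineticBranchOfUv.lean` (text of `stub_maxFormBound`).
attribute [local instance] Literature.MathematicalPhysics.QuantumManyBody.BoseGas.formDomain_measureSpace
  Literature.MathematicalPhysics.QuantumManyBody.BoseGas.formDomain_isProbabilityMeasure
  Literature.MathematicalPhysics.QuantumManyBody.BoseGas.formDomain_isProbabilityMeasure_pi

/-! ### Vocabulary of the line (all over existing declarations) -/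

/-- The Bogoliubov vertex of the mode `p = 2πk/L`, `L = (N/ρ)^{1/3}`: `g_p = 8πa + |p|²/(2ρ)`
(so that `ρ g_p = 8πρa + |p|²/2 = e_p²/(2|p|²)` and `N/(4θρg_p) = θ⁻¹ · N|p|²/(2e_p²)` is `θ⁻¹` times
Bogoliubov's static response). -/
def vertex (v : ℝ → ℝ≥0∞) (ρ : ℝ) (N : ℕ) (k : Fin 3 → ℤ) : ℝ :=
  8 * Real.pi * (scatteringLength v).toReal + psq (sideLength ρ N) k / (2 * ρ)

/-- `⟨|ρ̂_p|²⟩_Φ = ∫_{cell^N} |∑ⱼ e^{ip·xⱼ}|² |Φ|²` — the raw second moment of the density wave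
(`densityWave`, BoseGasStructureFactor) in the state `Φ`; `= N S_Φ(p) + |⟨ρ̂_p⟩_Φ|²`. -/
def densityWaveSqMean {N : ℕ} (L : ℝ) (k : Fin 3 → ℤ) (Φ : PeriodicTrialState N L) : ℝ :=
  ∫ X in cellN N L, ‖densityWave N L k X‖ ^ 2 * ‖Φ.ψ X‖ ^ 2

/-- The SOFTENED energy `F_g(Φ) = ⟨Φ, (H − (g/L³)(|ρ̂_p|² − N)) Φ⟩` of a finite-energy periodic state. -/
def softenedEnergy (v : ℝ → ℝ≥0∞) {N : ℕ} {L : ℝ} (g : ℝ) (k : Fin 3 → ℤ)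
    (Φ : PeriodicTrialState N L) : ℝ :=
  (periodicEnergy v Φ).toReal - g / L ^ 3 * (densityWaveSqMean L k Φ - N)

/-- `Φ` is a finite-energy `δ`-near-minimiser of the softened functional `F_g` among the finite-energy
periodic states. -/
def IsSoftenedNearMin (v : ℝ → ℝ≥0∞) {N : ℕ} {L : ℝ} (g : ℝ) (k : Fin 3 → ℤ) (δ : ℝ)
    (Φ : PeriodicTrialState N L) : Prop :=
  periodicEnergy v Φ ≠ ⊤ ∧
    ∀ Φ' : PeriodicTrialState N L, periodicEnergy v Φ' ≠ ⊤ →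
      softenedEnergy v g k Φ ≤ softenedEnergy v g k Φ' + δ

/-- The crux's inner inequality on the PHONON + CROSSOVER branch `|p|² ≤ M₀² ρa`, `N ≥ 1`. -/
def PhononBody (v : ℝ → ℝ≥0∞) (M₀ ρ₀ C : ℝ) : Prop :=
  ∀ ρ : ℝ, 0 < ρ → ρ < ρ₀ → ∀ N : ℕ, 0 < N → ∀ k : Fin 3 → ℤ, k ≠ 0 →
    psq (sideLength ρ N) k ≤ M₀ ^ 2 * (ρ * (scatteringLength v).toReal) →
    ∀ t : ℝ, ∀ Ψ : PeriodicTrialState N (sideLength ρ N), periodicEnergy v Ψ ≠ ⊤ →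
      Ineq v C ρ N k t Ψ

/-- The crux's inner inequality on the KINETIC branch `|p|² > M₀² ρa`, `N ≥ 1`. -/
def KineticBody (v : ℝ → ℝ≥0∞) (M₀ ρ₀ C : ℝ) : Prop :=
  ∀ ρ : ℝ, 0 < ρ → ρ < ρ₀ → ∀ N : ℕ, 0 < N → ∀ k : Fin 3 → ℤ, k ≠ 0 →
    M₀ ^ 2 * (ρ * (scatteringLength v).toReal) < psq (sideLength ρ N) k →
    ∀ t : ℝ, ∀ Ψ : PeriodicTrialState N (sideLength ρ N), periodicEnergy v Ψ ≠ ⊤ →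
      Ineq v C ρ N k t Ψ

/-- The crux restricted to the phonon + crossover branch, for EVERY window parameter `M₀`. -/
def StaticResponseBoundPhonon : Prop :=
  ∀ v : ℝ → ℝ≥0∞, IsRepulsiveFiniteRange v → ∀ M₀ : ℝ, 0 < M₀ →
    ∃ ρ₀ : ℝ, 0 < ρ₀ ∧ ∃ C : ℝ, 0 < C ∧ PhononBody v M₀ ρ₀ C

/-- The crux restricted to the kinetic branch for SOME window parameter `M₀`. -/
def StaticResponseBoundKinetic : Prop :=
  ∀ v : ℝ → ℝ≥0∞, IsRepulsiveFiniteRange v →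
    ∃ M₀ : ℝ, 0 < M₀ ∧ ∃ ρ₀ : ℝ, 0 < ρ₀ ∧ ∃ C : ℝ, 0 < C ∧ KineticBody v M₀ ρ₀ C

/-! ### The stub statements as readable `Prop`s -/

/-- **A — softened-mode hyperuniformity.** See the planner's card; `θ` existential and meant small. -/
def SoftenedModeHyperuniformity : Prop :=
  ∀ v : ℝ → ℝ≥0∞, IsRepulsiveFiniteRange v → ∀ M₀ : ℝ, 0 < M₀ →
    ∃ ρ₀ : ℝ, 0 < ρ₀ ∧ ∃ θ : ℝ, 0 < θ ∧ ∃ C_H : ℝ, 0 ≤ C_H ∧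
      ∀ ρ : ℝ, 0 < ρ → ρ < ρ₀ → ∀ N : ℕ, 0 < N → ∀ k : Fin 3 → ℤ, k ≠ 0 →
        psq (sideLength ρ N) k ≤ M₀ ^ 2 * (ρ * (scatteringLength v).toReal) →
        ∃ δ : ℝ, 0 < δ ∧ ∀ Φ : PeriodicTrialState N (sideLength ρ N),
          IsSoftenedNearMin v (θ * vertex v ρ N k) k δ Φ →
            densityWaveSqMean (sideLength ρ N) k Φ ≤
              C_H * N * Real.sqrt (psq (sideLength ρ N) k) /
                Real.sqrt (ρ * (scatteringLength v).toReal)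

/-- **B — sector floor (Landau with saturation), all `N ≥ 1`.** -/
def SectorFloor : Prop :=
  ∀ v : ℝ → ℝ≥0∞, IsRepulsiveFiniteRange v → ∀ M₀ : ℝ, 0 < M₀ →
    ∃ θL : ℝ, 0 < θL ∧ ∃ ρ₀ : ℝ, 0 < ρ₀ ∧ ∀ ρ : ℝ, 0 < ρ → ρ < ρ₀ → ∀ N : ℕ, 0 < N →
      ∀ m : Fin 3 → ℤ, m ≠ 0 →
        periodicGroundStateEnergy v N (sideLength ρ N)
            + ENNReal.ofReal (θL * Real.sqrt (ρ * (scatteringLength v).toReal)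
                * min (Real.sqrt (psq (sideLength ρ N) m))
                      (M₀ * Real.sqrt (ρ * (scatteringLength v).toReal)))
          ≤ momentumSectorEnergy v N (sideLength ρ N)
              ((2 * Real.pi / sideLength ρ N) •
                (WithLp.toLp 2 fun t => (m t : ℝ) : EuclideanSpace ℝ (Fin 3)))

/-- **ECSF — energy-controlled structure factor on the window** (conclusion of C1, first hypothesis of C3):
`(θg_p/L³)⟨|ρ̂_p|²⟩_Φ ≤ (E_Φ − E₀) + (θg_p/L³)·C_H N|p|/√(ρa)` for EVERY finite-energy `Φ`. -/
def EnergyControlledStructureFactor : Prop :=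
  ∀ v : ℝ → ℝ≥0∞, IsRepulsiveFiniteRange v → ∀ M₀ : ℝ, 0 < M₀ →
    ∃ ρ₀ : ℝ, 0 < ρ₀ ∧ ∃ θ : ℝ, 0 < θ ∧ ∃ C_H : ℝ, 0 ≤ C_H ∧
      ∀ ρ : ℝ, 0 < ρ → ρ < ρ₀ → ∀ N : ℕ, 0 < N → ∀ k : Fin 3 → ℤ, k ≠ 0 →
        psq (sideLength ρ N) k ≤ M₀ ^ 2 * (ρ * (scatteringLength v).toReal) →
        ∀ Φ : PeriodicTrialState N (sideLength ρ N), periodicEnergy v Φ ≠ ⊤ →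
          θ * vertex v ρ N k / sideLength ρ N ^ 3 * densityWaveSqMean (sideLength ρ N) k Φ ≤
            (periodicEnergy v Φ).toReal - (periodicGroundStateEnergy v N (sideLength ρ N)).toReal +
              θ * vertex v ρ N k / sideLength ρ N ^ 3 *
                (C_H * N * Real.sqrt (psq (sideLength ρ N) k) /
                  Real.sqrt (ρ * (scatteringLength v).toReal))

/-- **Sector decomposition** of a periodic `C¹` state (conclusion of C2α): a family of centre-of-mass
Fourier (Bloch) components `Φc q`, `q ∈ ℤ³` — each `C¹`, `Lℤ³`-periodic in every particle, Bose-symmetric,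
of total momentum `2πq/L` — with Parseval for the norm (`∑_q ‖Φc q‖² = 1`), for the energy form including the
interaction (`∑_q ⟨Φc q, H Φc q⟩ = ⟨Ψ, HΨ⟩` in `[0,∞]`, hard cores included), and for the density-wave pairing
(`∑_q ⟨Φc (q+k), ρ̂_k Φc q⟩ = ⟨Ψ, ρ̂_k Ψ⟩`).  Intended witness:
`Φc q X = L⁻³ ∫_{[0,L)³} e^{−2πi q·s/L} Ψ(x₁+s, …, x_N+s) ds`. -/
def SectorDecomposition : Prop :=
  ∀ (v : ℝ → ℝ≥0∞) (N : ℕ) (L : ℝ), 0 < L → ∀ (k : Fin 3 → ℤ) (Ψ : PeriodicTrialState N L),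
    ∃ Φc : (Fin 3 → ℤ) → Config N → ℂ,
      (∀ q, ContDiff ℝ 1 (Φc q)) ∧
      (∀ q (X : Config N) (i : Fin N) (a : Fin 3),
        Φc q (X + Pi.single i (EuclideanSpace.single a L)) = Φc q X) ∧
      (∀ q (σ : Equiv.Perm (Fin N)) (X : Config N), Φc q (X ∘ σ) = Φc q X) ∧
      (∀ q, HasTotalMomentum
        ((2 * Real.pi / L) • (WithLp.toLp 2 fun t => (q t : ℝ) : EuclideanSpace ℝ (Fin 3))) (Φc q)) ∧
      (∑' q, ∫⁻ X in cellN N L, (‖Φc q X‖₊ : ℝ≥0∞) ^ 2) = 1 ∧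
      (∑' q, ∫⁻ X in cellN N L,
          (kineticDensity (Φc q) X + periodicInteraction v L X * (‖Φc q X‖₊ : ℝ≥0∞) ^ 2)) =
        periodicEnergy v Ψ ∧
      HasSum (fun q : Fin 3 → ℤ =>
          ∫ X in cellN N L, conj (Φc (q + k) X) * (densityWave N L k X * Φc q X))
        (∫ X in cellN N L, densityWave N L k X * (((‖Ψ.ψ X‖ ^ 2 : ℝ)) : ℂ))

/-- **Sector Cauchy–Schwarz** (conclusion of C2β, third hypothesis of C3): at fixed `(N, L, k)`, an
energy-controlled structure factor with constants `(λ, D)` for all finite-energy states and a floor `Δ > 0`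
above `E₀` on the stiffer member of every sector pair `(q, q+k)` give, for every finite-energy `Ψ`,
`⟨∑ⱼcos(p·xⱼ)⟩_Ψ² ≤ 4((1 + D/Δ)/λ)(E_Ψ − E₀)`. -/
def SectorCauchySchwarz : Prop :=
  ∀ (v : ℝ → ℝ≥0∞) (N : ℕ) (L : ℝ), 0 < L → ∀ (k : Fin 3 → ℤ), k ≠ 0 →
    ∀ (lam D Δ : ℝ), 0 < lam → 0 ≤ D → 0 < Δ →
    (∀ Φ : PeriodicTrialState N L, periodicEnergy v Φ ≠ ⊤ →
      lam * ∫ X in cellN N L, ‖densityWave N L k X‖ ^ 2 * ‖Φ.ψ X‖ ^ 2 ≤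
        (periodicEnergy v Φ).toReal - (periodicGroundStateEnergy v N L).toReal + D) →
    (∀ q : Fin 3 → ℤ,
      periodicGroundStateEnergy v N L + ENNReal.ofReal Δ ≤
          momentumSectorEnergy v N L
            ((2 * Real.pi / L) • (WithLp.toLp 2 fun t => (q t : ℝ) : EuclideanSpace ℝ (Fin 3))) ∨
      periodicGroundStateEnergy v N L + ENNReal.ofReal Δ ≤
          momentumSectorEnergy v N L
            ((2 * Real.pi / L) • (WithLp.toLp 2 fun t => ((q + k) t : ℝ) : EuclideanSpace ℝ (Fin 3)))) →
    ∀ Ψ : PeriodicTrialState N L, periodicEnergy v Ψ ≠ ⊤ →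
      cosMean L k Ψ ^ 2 ≤
        4 * ((1 + D / Δ) / lam) *
          ((periodicEnergy v Ψ).toReal - (periodicGroundStateEnergy v N L).toReal)

/-- **Stub C — the window reduction** `A → B → StaticResponseBoundPhonon` (a theorem of this file modulo
C1, C2α, C2β, C3: `stub_windowReduction` below). -/
def WindowReduction : Prop :=
  SoftenedModeHyperuniformity → SectorFloor → StaticResponseBoundPhonon

/-! ### The REGISTERED stubs (v2), statements written out in tree vocabulary -/

/-- **ECSF (lead; XL, crux-sized) `stub_energyControlledStructureFactor`** — skeleton v4 registers the
energy-controlled structure factor ITSELF in place of the planner's stub A (softened-mode hyperuniformity):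
A ⟹ ECSF is the landed C1 (`stub_ecsf_of_hyperuniformity`, p81508) and ECSF(ρ₀,θ,C_H) ⟹ A(ρ₀,θ/2,2C_H+1) is the
drefuter's landed `Negative/SoftenedModeHyperuniformityOfEcsf.lean` (p83834), so A ⟺ ECSF and the softened functional
is a costume (drefute g4).  Statement (verbatim `EnergyControlledStructureFactor`, `vertex`/`densityWaveSqMean` unfolded):
for every admissible `v` and window `M₀` there are `ρ₀, θ > 0`, `C_H ≥ 0` such that for `ρ < ρ₀`, all `N ≥ 1`, all
`k ≠ 0` with `|p|² ≤ M₀²ρa` and EVERY finite-energy periodic state `Φ`: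
`(θg_p/L³) ⟨|ρ̂_p|²⟩_Φ ≤ (E_Φ − E₀) + (θg_p/L³)·C_H N|p|/√(ρa)`, `g_p = 8πa + |p|²/(2ρ)` — as a form inequality on the
Bose sector: `|ρ̂_p|² ≤ (N/(θ(8πρa+|p|²/2)))(H − E₀) + C_H N|p|/√(ρa)`.  At `Φ = ` a near-ground state this is
hyperuniformity `S(p) ≤ C_H|p|ξ` for ALL `N` (TorusHyperuniformity stmt-9093 is the `∀ᶠ N` ground-state version); for
excited states it bounds density fluctuations by excitation energy; equivalently the ground-state energy of the
mean-field-softened Hamiltonian `H − (θg_p/L³)|ρ̂_p|²` lies at most ONE phonon energy (`θρg_pC_H|p|ξ`) below `E₀ − θρg_p·0`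
— an INTENSIVE energy shift under an extensive-looking perturbation. No theorem of this kind exists outside GP scaling. -/
theorem stub_energyControlledStructureFactor :
    ∀ v : ℝ → ℝ≥0∞, IsRepulsiveFiniteRange v → ∀ M₀ : ℝ, 0 < M₀ →
      ∃ ρ₀ : ℝ, 0 < ρ₀ ∧ ∃ θ : ℝ, 0 < θ ∧ ∃ C_H : ℝ, 0 ≤ C_H ∧
        ∀ ρ : ℝ, 0 < ρ → ρ < ρ₀ → ∀ N : ℕ, 0 < N → ∀ k : Fin 3 → ℤ, k ≠ 0 →
          psq (sideLength ρ N) k ≤ M₀ ^ 2 * (ρ * (scatteringLength v).toReal) →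
          ∀ Φ : PeriodicTrialState N (sideLength ρ N), periodicEnergy v Φ ≠ ⊤ →
            θ * (8 * Real.pi * (scatteringLength v).toReal + psq (sideLength ρ N) k / (2 * ρ)) /
                sideLength ρ N ^ 3 *
                (∫ X in cellN N (sideLength ρ N),
                  ‖densityWave N (sideLength ρ N) k X‖ ^ 2 * ‖Φ.ψ X‖ ^ 2) ≤
              (periodicEnergy v Φ).toReal - (periodicGroundStateEnergy v N (sideLength ρ N)).toReal +
                θ * (8 * Real.pi * (scatteringLength v).toReal + psq (sideLength ρ N) k / (2 * ρ)) /
                  sideLength ρ N ^ 3 *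
                  (C_H * N * Real.sqrt (psq (sideLength ρ N) k) /
                    Real.sqrt (ρ * (scatteringLength v).toReal)) := by
  sorry

/-- **B (XL)** `stub_sectorFloor` — verbatim `SectorFloor`. -/
theorem stub_sectorFloor :
    ∀ v : ℝ → ℝ≥0∞, IsRepulsiveFiniteRange v → ∀ M₀ : ℝ, 0 < M₀ →
      ∃ θL : ℝ, 0 < θL ∧ ∃ ρ₀ : ℝ, 0 < ρ₀ ∧ ∀ ρ : ℝ, 0 < ρ → ρ < ρ₀ → ∀ N : ℕ, 0 < N →
        ∀ m : Fin 3 → ℤ, m ≠ 0 →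
          periodicGroundStateEnergy v N (sideLength ρ N)
              + ENNReal.ofReal (θL * Real.sqrt (ρ * (scatteringLength v).toReal)
                  * min (Real.sqrt (psq (sideLength ρ N) m))
                        (M₀ * Real.sqrt (ρ * (scatteringLength v).toReal)))
            ≤ momentumSectorEnergy v N (sideLength ρ N)
                ((2 * Real.pi / sideLength ρ N) •
                  (WithLp.toLp 2 fun t => (m t : ℝ) : EuclideanSpace ℝ (Fin 3))) := by
  sorry





/-! ### Stub D expanded (skeleton v3): the kinetic branch from the sibling line's registered stubs

After wave 1 the interface stub D `stub_kineticBranch` is GLUE: the landed kernel composition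
`kineticBranch_of_uvStubs` (p87668, `Theorems/…KineticBranchOfUv.lean`, adapted from the sibling skeleton's
`kineticBranch_of` with S4 p74247, S6 p73757 and the bridges p77117, p77380) applied to the three registered stubs
of line `uv-thomson-force-wave` (re-registered on the item by this lead): `stub_maxFormBound` (classical, L),
`stub_modulatedMinimiserExists` (F1, classical, L–XL), `stub_uvForceWaveBound` (S5, crux-sized UV heart). -/

/-- **(MaxFormBound) `stub_maxFormBound`** (classical, L; sibling line's registered text verbatim): the
Bose-symmetric periodic `C¹` core realises the infimum of the MAXIMAL hard-core form (no Lavrentiev gap) —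
hypothesis `hcore` of the landed `UvThomsonForceWave.truncationLimit_of_maxFormBound` (p77117).
[cite: B. Simon, J. Operator Theory 1 (1979) 37; Adams–Hedberg Thm 9.1.3] -/
theorem stub_maxFormBound :
    ∀ v : ℝ → ℝ≥0∞, IsRepulsiveFiniteRange v → ∀ (N : ℕ) (L : ℝ), 0 < L → ∀ η : Lp ℂ 2 (volume : Measure
      (UnitAddTorus (Fin N × Fin 3))), ‖η‖ = 1 → (∀ (σ : Equiv.Perm (Fin N)) (n : Fin N × Fin 3 → ℤ),
      ⟪(mFourierLp 2 (fun p : Fin N × Fin 3 => n (σ p.1, p.2)) : Lp ℂ 2 (volume : Measure (UnitAddTorus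
      (Fin N × Fin 3)))), η⟫_ℂ = ⟪(mFourierLp 2 n : Lp ℂ 2 (volume : Measure (UnitAddTorus (Fin N × Fin
      3)))), η⟫_ℂ) → periodicGroundStateEnergy v N L ≤ ∑' n : Fin N × Fin 3 → ℤ, ENNReal.ofReal (∑ p, (2 *
      Real.pi * (n p : ℝ) / L) ^ 2) * (‖⟪(mFourierLp 2 n : Lp ℂ 2 (volume : Measure (UnitAddTorus (Fin N ×
      Fin 3)))), η⟫_ℂ‖₊ : ℝ≥0∞) ^ 2 + ∫⁻ t, periodicInteraction v L (fromUnitTorusN L t) * (‖(η :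
      UnitAddTorus (Fin N × Fin 3) → ℂ) t‖₊ : ℝ≥0∞) ^ 2 := by
  sorry

/-- **(F1) `stub_modulatedMinimiserExists`** (classical, L–XL; sibling line's registered text verbatim):
existence of positive real `C¹` minimisers of `E_w + s⟨∑cos⟩` for bounded admissible `w` (Perron–Frobenius for
`−Δ + W + sV_p` on the flat torus + `C¹` regularity) — hypothesis of the landed
`UvThomsonForceWave.stub_modulationBootstrap_of_exists` (p77380). Recommended route (lead -0 memo,
Cruxes/StaticResponseBound/NOTES.md): extend the tree's periodic Feynman–Kac programme (`pfkL2_perronFrobenius`).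
[cite: ReedSimonIV1978, Thm XIII.47] -/
theorem stub_modulatedMinimiserExists :
    ∀ w : ℝ → ℝ≥0∞, IsRepulsiveFiniteRange w → (∃ M : ℝ≥0∞, M ≠ ⊤ ∧ ∀ r, w r ≤ M) → ∀ (N : ℕ), 1 ≤ N → ∀
      (L : ℝ), 0 < L → ∀ (k : Fin 3 → ℤ), k ≠ 0 → ∀ s : ℝ, ∃ Φ : PeriodicTrialState N L, (∀ X, Φ.ψ X =
      (‖Φ.ψ X‖ : ℂ)) ∧ (∀ X, Φ.ψ X ≠ 0) ∧ periodicEnergy w Φ ≠ ⊤ ∧ ∀ Ψ : PeriodicTrialState N L,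
      periodicEnergy w Ψ ≠ ⊤ → (periodicEnergy w Φ).toReal + s * cosMean L k Φ ≤ (periodicEnergy w
      Ψ).toReal + s * cosMean L k Ψ := by
  sorry

/-- **(S5) `stub_uvForceWaveBound`** (XL, crux-sized UV heart; sibling line's registered text verbatim; handed
back `promote-stub` by lead -0): the `H₋₁(|Φ|²)` bound `K·N` on the centred force-density wave of the weakly
modulated positive ground states of `v_n` on the UV window `Λρa ≤ |p|²`; kernel-equivalent to the N-uniform UV
static-susceptibility bound (p76206). -/
theorem stub_uvForceWaveBound :
    ∀ v : ℝ → ℝ≥0∞, IsRepulsiveFiniteRange v → ∃ Λ : ℝ, 1 ≤ Λ ∧ ∃ ρ₁ : ℝ, 0 < ρ₁ ∧ ∃ K : ℝ, 0 ≤ K ∧ ∃ n₀ :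
      ℕ, ∀ n : ℕ, n₀ ≤ n → ∀ ρ : ℝ, 0 < ρ → ρ < ρ₁ → ∀ N : ℕ, 1 ≤ N → ∀ k : Fin 3 → ℤ, k ≠ 0 → Λ * (ρ *
      (scatteringLength v).toReal) ≤ psq (sideLength ρ N) k → ∀ s : ℝ, s ^ 2 ≤ psq (sideLength ρ N) k *
      (periodicGroundStateEnergy (truncPotential v n) N (sideLength ρ N)).toReal / N → ∀ Φ :
      PeriodicTrialState N (sideLength ρ N), (∀ X, Φ.ψ X = (‖Φ.ψ X‖ : ℂ)) → (∀ X, Φ.ψ X ≠ 0) →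
      periodicEnergy (truncPotential v n) Φ ≠ ⊤ → (∀ Ψ : PeriodicTrialState N (sideLength ρ N),
      periodicEnergy (truncPotential v n) Ψ ≠ ⊤ → (periodicEnergy (truncPotential v n) Φ).toReal + s *
      cosMean (sideLength ρ N) k Φ ≤ (periodicEnergy (truncPotential v n) Ψ).toReal + s * cosMean
      (sideLength ρ N) k Ψ) → hMinusOneSqW (sideLength ρ N) (fun X => ‖Φ.ψ X‖) (fun X => ((∑ j : Fin N,
      Real.sin (2 * Real.pi / sideLength ρ N * ∑ i, (k i : ℝ) * X j i) * ∑ i : Fin 3, ((k i : ℝ) /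
      Real.sqrt (∑ l, (k l : ℝ) ^ 2)) * pderiv j i (fun Y => ‖Φ.ψ Y‖ ^ 2) X) / ‖Φ.ψ X‖ ^ 2) - ∫ Y in cellN
      N (sideLength ρ N), ((∑ j : Fin N, Real.sin (2 * Real.pi / sideLength ρ N * ∑ i, (k i : ℝ) * Y j i)
      * ∑ i : Fin 3, ((k i : ℝ) / Real.sqrt (∑ l, (k l : ℝ) ^ 2)) * pderiv j i (fun Y => ‖Φ.ψ Y‖ ^ 2) Y) /
      ‖Φ.ψ Y‖ ^ 2) * ‖Φ.ψ Y‖ ^ 2) ≤ ENNReal.ofReal (K * N) := by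
  sorry

/-- **D is GLUE (v3)**: the kinetic branch from the three sibling stubs by the landed composition
`kineticBranch_of_uvStubs` (p87668). -/
theorem stub_kineticBranch :
    ∀ v : ℝ → ℝ≥0∞, IsRepulsiveFiniteRange v →
      ∃ M₀ : ℝ, 0 < M₀ ∧ ∃ ρ₀ : ℝ, 0 < ρ₀ ∧ ∃ C : ℝ, 0 < C ∧
        ∀ ρ : ℝ, 0 < ρ → ρ < ρ₀ → ∀ N : ℕ, 0 < N → ∀ k : Fin 3 → ℤ, k ≠ 0 →
          M₀ ^ 2 * (ρ * (scatteringLength v).toReal) < psq (sideLength ρ N) k →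
          ∀ t : ℝ, ∀ Ψ : PeriodicTrialState N (sideLength ρ N), periodicEnergy v Ψ ≠ ⊤ →
            Ineq v C ρ N k t Ψ :=
  kineticBranch_of_uvStubs stub_maxFormBound stub_modulatedMinimiserExists stub_uvForceWaveBound

/-! ### The registered texts ARE the readable statements (definitional unfolding) -/

/-- ECSF by name (registered stub of v4). -/
theorem energyControlledStructureFactor_holds : EnergyControlledStructureFactor :=
  stub_energyControlledStructureFactor

/-- B by name. -/
theorem sectorFloor_holds : SectorFloor := stub_sectorFloor

/-- C1 by name (LANDED p81508, `Theorems/…EcsfOfHyperuniformity.lean`): A ⟹ ECSF. -/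
theorem ecsf_of_hyperuniformity : SoftenedModeHyperuniformity → EnergyControlledStructureFactor :=
  stub_ecsf_of_hyperuniformity

/-- C2α by name (LANDED p85983 + p85000, p85013, `Theorems/…SectorDecomposition*.lean`). -/
theorem sectorDecomposition_holds : SectorDecomposition := stub_sectorDecomposition

/-- C2β by name (LANDED p87427, `Theorems/…SectorCauchySchwarz.lean`). -/
theorem sectorCauchySchwarz_of_decomposition : SectorDecomposition → SectorCauchySchwarz :=
  stub_sectorCauchySchwarz

/-- C3 by name (LANDED p87701, `Theorems/…WindowAssembly.lean`). -/
theorem windowAssembly :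
    EnergyControlledStructureFactor → SectorFloor → SectorCauchySchwarz → StaticResponseBoundPhonon :=
  stub_windowAssembly

/-- D by name (GLUE since v3: `kineticBranch_of_uvStubs` p87668 on the three sibling stubs). -/
theorem kineticBranch_holds : StaticResponseBoundKinetic := stub_kineticBranch

/-- **Stub C of the planner's skeleton is a THEOREM** (all four parts landed in wave 1):
`WindowReduction : A → B → StaticResponseBoundPhonon`. -/
theorem stub_windowReduction : WindowReduction := fun hA hB =>
  windowAssembly (ecsf_of_hyperuniformity hA) hB
    (sectorCauchySchwarz_of_decomposition sectorDecomposition_holds)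

/-- **The IR half from ECSF and the sector floor directly** (v4): `ECSF → B → StaticResponseBoundPhonon`,
sorry-free glue over the landed C2α, C2β, C3. -/
theorem phonon_of_ecsf_of_sectorFloor :
    EnergyControlledStructureFactor → SectorFloor → StaticResponseBoundPhonon := fun hE hB =>
  windowAssembly hE hB (sectorCauchySchwarz_of_decomposition sectorDecomposition_holds)

/-! ### Calibration against the existing cruxes of route BECSectorPoincareTwoScale (landed glue)

The two open cores of this line are at least as strong as the two open cruxes of the sibling route, BY NAME: -/

/-- **SectorFloor ⟹ LandauSectorBound (stmt-AtomisticToContinuum-9091)** — via the landed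
`landauSectorBound_of_sectorFloor` (p89438): B is 9091 for ALL `N` at exact density (+ the far floor). -/
theorem landauSectorBound_of_B :
    _root_.Summit.AtomisticToContinuum.BoseEinsteinCondensation.Theses.BECSectorPoincareTwoScale.LandauSectorBound :=
  landauSectorBound_of_sectorFloor stub_sectorFloor

-- **ECSF ⟹ TorusHyperuniformity (stmt-AtomisticToContinuum-9093)** is the landed `torusHyperuniformity_of_ecsf` (p89652,
-- `Theorems/…EcsfToTorusHyperuniformity.lean`): ECSF contains hyperuniformity of the near-ground states for ALL `N`
-- (and bounds excited states too).  Corollary here once the farm has built that module: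
--   theorem torusHyperuniformity_of_ECSF : BECSectorPoincareTwoScale.TorusHyperuniformity :=
--     torusHyperuniformity_of_ecsf stub_energyControlledStructureFactor

/-! ### The kernel-checked composition -/

/-- Monotonicity of the inner inequality in the constant (a larger `C` only weakens it). -/
theorem ineq_mono_C {v : ℝ → ℝ≥0∞} {C C' ρ : ℝ} {N : ℕ} {k : Fin 3 → ℤ} {t : ℝ}
    {Ψ : PeriodicTrialState N (sideLength ρ N)} (h : Ineq v C ρ N k t Ψ) (hCC' : C ≤ C') :
    Ineq v C' ρ N k t Ψ := by
  unfold Ineq at h ⊢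
  have hmax : 0 ≤ max (ρ * (scatteringLength v).toReal) (psq (sideLength ρ N) k) :=
    le_max_of_le_right (by unfold psq; positivity)
  have hle : C * t ^ 2 * N / max (ρ * (scatteringLength v).toReal) (psq (sideLength ρ N) k) ≤
      C' * t ^ 2 * N / max (ρ * (scatteringLength v).toReal) (psq (sideLength ρ N) k) := by
    apply div_le_div_of_nonneg_right _ hmax
    have : (0 : ℝ) ≤ t ^ 2 * N := by positivity
    nlinarith
  linarith

/-- **The composition (planner's shape)**: A, B, the window reduction and the kinetic branch imply the crux BY
NAME. `N = 0` is `Negative.ineq_N_zero`; for `N ≥ 1` split on `|p|² ≤ M₀²ρa` with `M₀` taken from the kinetic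
stub, `ρ₀ := min`, `C := max`. -/
theorem StaticResponseBound_of :
    SoftenedModeHyperuniformity → SectorFloor → WindowReduction → StaticResponseBoundKinetic →
      _root_.Summit.AtomisticToContinuum.BoseEinsteinCondensation.Theses.BECInsertionCorrector.StaticResponseBound := by
  intro hA hB hW hK
  rw [staticResponseBound_iff]
  intro v hv
  obtain ⟨M₀, hM₀, ρ₁, hρ₁, C₁, hC₁, hKin⟩ := hK v hv
  obtain ⟨ρ₂, hρ₂, C₂, hC₂, hPh⟩ := hW hA hB v hv M₀ hM₀
  refine ⟨min ρ₁ ρ₂, lt_min hρ₁ hρ₂, max C₁ C₂, lt_of_lt_of_le hC₁ (le_max_left _ _), ?_⟩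
  intro ρ hρ hρlt N k hk t Ψ hΨ
  rcases Nat.eq_zero_or_pos N with hN | hN
  · subst hN
    exact ineq_N_zero v _ ρ k t Ψ hΨ
  · rcases le_or_gt (psq (sideLength ρ N) k) (M₀ ^ 2 * (ρ * (scatteringLength v).toReal)) with hle | hlt
    · exact ineq_mono_C (hPh ρ hρ (lt_of_lt_of_le hρlt (min_le_right _ _)) N hN k hk hle t Ψ hΨ)
        (le_max_right _ _)
    · exact ineq_mono_C (hKin ρ hρ (lt_of_lt_of_le hρlt (min_le_left _ _)) N hN k hk hlt t Ψ hΨ)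
        (le_max_left _ _)

/-- **The composition (v4 shape)**: ECSF, the sector floor and the kinetic branch imply the crux BY NAME
(same case split; the IR half is `phonon_of_ecsf_of_sectorFloor`). -/
theorem StaticResponseBound_of_ecsf :
    EnergyControlledStructureFactor → SectorFloor → StaticResponseBoundKinetic →
      _root_.Summit.AtomisticToContinuum.BoseEinsteinCondensation.Theses.BECInsertionCorrector.StaticResponseBound := by
  intro hE hB hK
  rw [staticResponseBound_iff]
  intro v hv
  obtain ⟨M₀, hM₀, ρ₁, hρ₁, C₁, hC₁, hKin⟩ := hK v hv
  obtain ⟨ρ₂, hρ₂, C₂, hC₂, hPh⟩ := phonon_of_ecsf_of_sectorFloor hE hB v hv M₀ hM₀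
  refine ⟨min ρ₁ ρ₂, lt_min hρ₁ hρ₂, max C₁ C₂, lt_of_lt_of_le hC₁ (le_max_left _ _), ?_⟩
  intro ρ hρ hρlt N k hk t Ψ hΨ
  rcases Nat.eq_zero_or_pos N with hN | hN
  · subst hN
    exact ineq_N_zero v _ ρ k t Ψ hΨ
  · rcases le_or_gt (psq (sideLength ρ N) k) (M₀ ^ 2 * (ρ * (scatteringLength v).toReal)) with hle | hlt
    · exact ineq_mono_C (hPh ρ hρ (lt_of_lt_of_le hρlt (min_le_right _ _)) N hN k hk hle t Ψ hΨ)
        (le_max_right _ _)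
    · exact ineq_mono_C (hKin ρ hρ (lt_of_lt_of_le hρlt (min_le_left _ _)) N hN k hk hlt t Ψ hΨ)
        (le_max_left _ _)

/-- **`StaticResponseBound` from the line `stable-fraction-square-completion`** (skeleton v4): the crux BY NAME —
the only `sorry`s in its cone are the registered stubs ECSF (`stub_energyControlledStructureFactor`), B
(`stub_sectorFloor`) and, through the glue D, the sibling stubs `stub_maxFormBound`, `stub_modulatedMinimiserExists`,
`stub_uvForceWaveBound`. -/
theorem StaticResponseBound_proof :
    _root_.Summit.AtomisticToContinuum.BoseEinsteinCondensation.Theses.BECInsertionCorrector.StaticResponseBound :=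
  StaticResponseBound_of_ecsf energyControlledStructureFactor_holds sectorFloor_holds kineticBranch_holds


/-! ### Calibration II (skeleton v5, lead -2): the `fsum-sector-sandwich` bricks as registered stubs

The planner's brick library `Lines/fsum-sector-sandwich.lean` (crux-plan verdict `no-skeleton`: the moment sandwich reaches only
the `t → 0` content; triage r1 ×3: merge-absorb into this line) typed four bricks over existing declarations.  They are
registered here VERBATIM (tree vocabulary: `hMinusOneSqW`, `dirichletFormW`, `IsPeriodicTest` of `WeightedCorrector`;
`sectorPoincareConstant`, `latticeVec`, `HasTotalMomentum` of `GroundStateDirichletForm` / `PeriodicBoseGasMomentumSector`;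
the crux's observable written out) so that workers land them `--supports`; the two compositions below are sorry-free.
B1 is the `(0, ±p)` sector pair of C2β in `H₋₁` dress; B4 is the floor transfer to an exact minimiser (ground-state
transform, shared with stmt-12060); B3 is the all-states form of stmt-12060; B2 is the converse brick `m₀² ≤ m₁ m₋₁`. -/

-- (v6) The four brick stubs `stub_sectorFloorToHMinusOne` (B1), `stub_energyFloorToPoincareFloor` (B4),
-- `stub_groundStateDiscriminant` (B3), `stub_responseToHyperuniformity` (B2) are LANDED and imported (see the module docstring);
-- their registered texts are the theorems of the same names in `Theorems/BECInsertionCorrectorStaticResponseBound{SectorFloorToHMinusOne,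
-- EnergyFloorToPoincareFloor,GroundStateDiscriminant,ResponseToHyperuniformity}.lean`.

/-! #### The brick statements by name and the two sorry-free compositions (H: route bypass, K: kill-edge) -/

/-- B1 by name. -/
def SectorFloorToHMinusOne : Prop :=
  ∀ (N : ℕ) (L : ℝ), 0 < L → ∀ (k : Fin 3 → ℤ) (Θ : PeriodicTrialState N L),
    HasTotalMomentum 0 Θ.ψ → ∀ ω : ℝ, 0 < ω →
      ENNReal.ofReal ω ≤ sectorPoincareConstant L Θ.ψ (latticeVec (2 * Real.pi / L) k) →
      hMinusOneSqW L (fun X => ‖Θ.ψ X‖)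
          (fun X => ∑ j, Real.cos (2 * Real.pi / L * ∑ i, (k i : ℝ) * X j i)) ≤
        ENNReal.ofReal (N * ((2 * Real.pi / L) ^ 2 * ∑ i, (k i : ℝ) ^ 2) / (2 * ω ^ 2))

/-- B4 by name. -/
def EnergyFloorToPoincareFloor : Prop :=
  ∀ (v : ℝ → ℝ≥0∞) (N : ℕ) (L : ℝ), 0 < L → ∀ (Θ : PeriodicTrialState N L),
    (∀ X, Θ.ψ X = (‖Θ.ψ X‖ : ℂ)) → HasTotalMomentum 0 Θ.ψ →
    periodicEnergy v Θ = periodicGroundStateEnergy v N L → periodicEnergy v Θ ≠ ⊤ →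
    ∀ (m : Fin 3 → ℤ) (ω : ℝ), 0 ≤ ω →
      periodicGroundStateEnergy v N L + ENNReal.ofReal ω ≤
          momentumSectorEnergy v N L (latticeVec (2 * Real.pi / L) m) →
      ENNReal.ofReal ω ≤ sectorPoincareConstant L Θ.ψ (latticeVec (2 * Real.pi / L) m)

/-- B3 by name. -/
def GroundStateDiscriminant : Prop :=
  ∀ (v : ℝ → ℝ≥0∞) (N : ℕ) (L : ℝ), 0 < L → ∀ (Θ : PeriodicTrialState N L),
    (∀ X, Θ.ψ X = (‖Θ.ψ X‖ : ℂ)) →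
    periodicEnergy v Θ = periodicGroundStateEnergy v N L → periodicEnergy v Θ ≠ ⊤ →
    ∀ (k : Fin 3 → ℤ) (B : ℝ), 0 ≤ B →
      (∀ (t : ℝ) (Ψ : PeriodicTrialState N L), periodicEnergy v Ψ ≠ ⊤ →
        (periodicGroundStateEnergy v N L).toReal - B * t ^ 2 ≤
          (periodicEnergy v Ψ).toReal +
            t * ∫ X in cellN N L,
              (∑ j, Real.cos (2 * Real.pi / L * ∑ i, (k i : ℝ) * X j i)) * ‖Ψ.ψ X‖ ^ 2) →
      ∀ F : Config N → ℝ, IsPeriodicTest L F →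
        (∀ (σ : Equiv.Perm (Fin N)) (X : Config N), F (X ∘ σ) = F X) →
        (∫ X in cellN N L,
            (∑ j, Real.cos (2 * Real.pi / L * ∑ i, (k i : ℝ) * X j i)) * F X ^ 2 * ‖Θ.ψ X‖ ^ 2) ^ 2 ≤
          4 * B * (∫ X in cellN N L, F X ^ 2 * ‖Θ.ψ X‖ ^ 2) *
            dirichletFormW L (fun X => ‖Θ.ψ X‖) F F

/-- B2 by name. -/
def ResponseToHyperuniformity : Prop :=
  ∀ (N : ℕ) (L : ℝ), 0 < L → ∀ (k : Fin 3 → ℤ), k ≠ 0 → ∀ (Θ : PeriodicTrialState N L),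
    HasTotalMomentum 0 Θ.ψ → ∀ K : ℝ, 0 ≤ K →
      (∀ F : Config N → ℝ, IsPeriodicTest L F →
        (∀ (σ : Equiv.Perm (Fin N)) (X : Config N), F (X ∘ σ) = F X) →
        (∫ X in cellN N L,
            (∑ j, Real.cos (2 * Real.pi / L * ∑ i, (k i : ℝ) * X j i)) * F X ^ 2 * ‖Θ.ψ X‖ ^ 2) ^ 2 ≤
          K * (∫ X in cellN N L, F X ^ 2 * ‖Θ.ψ X‖ ^ 2) *
            dirichletFormW L (fun X => ‖Θ.ψ X‖) F F) →
      (∫ X in cellN N L,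
          (∑ j, Real.cos (2 * Real.pi / L * ∑ i, (k i : ℝ) * X j i)) ^ 2 * ‖Θ.ψ X‖ ^ 2) ^ 2 ≤
        K * (N * psq L k / 8)

/-- B1 holds (LANDED p99868 over Part1 p98114). -/
theorem sectorFloorToHMinusOne_holds : SectorFloorToHMinusOne := stub_sectorFloorToHMinusOne
/-- B4 holds (LANDED p97465). -/
theorem energyFloorToPoincareFloor_holds : EnergyFloorToPoincareFloor := stub_energyFloorToPoincareFloor
/-- B3 holds (LANDED p97054). -/
theorem groundStateDiscriminant_holds : GroundStateDiscriminant := stub_groundStateDiscriminant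
/-- B2 holds (LANDED p97762). -/
theorem responseToHyperuniformity_holds : ResponseToHyperuniformity := stub_responseToHyperuniformity

/-- `L = (N/ρ)^{1/3} > 0` for `N ≥ 1`, `ρ > 0`. -/
theorem sideLength_pos' {ρ : ℝ} (hρ : 0 < ρ) {N : ℕ} (hN : 0 < N) : 0 < sideLength ρ N := by
  unfold sideLength
  apply Real.rpow_pos_of_pos
  have : (0 : ℝ) < N := by exact_mod_cast hN
  positivity

/-- The Bloch phase of `LandauSectorBound` is the character of `latticeVec (2π/L) m`. -/
theorem sum_latticeVec_mul (L : ℝ) (m : Fin 3 → ℤ) (s : EuclideanSpace ℝ (Fin 3)) :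
    (∑ j, (latticeVec (2 * Real.pi / L) m) j * s j) = 2 * Real.pi / L * ∑ t, (m t : ℝ) * s t := by
  rw [Finset.mul_sum]
  exact Finset.sum_congr rfl fun t _ => by simp only [latticeVec, PiLp.toLp_apply]; ring

/-- The literal sector-floor body of `LandauSectorBound` at one `(N, L, m)` is a floor on `momentumSectorEnergy` at
`latticeVec (2π/L) m`. -/
theorem momentumSectorEnergy_floor_of_literal (v : ℝ → ℝ≥0∞) (N : ℕ) (L : ℝ) (m : Fin 3 → ℤ)
    (e : ℝ≥0∞)
    (h : ∀ Ψ : PeriodicTrialState N L,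
      (∀ (X : Config N) (s : EuclideanSpace ℝ (Fin 3)), Ψ.ψ (fun j => X j + s) =
        Complex.exp (Complex.I * ↑(2 * Real.pi / L * ∑ t : Fin 3, (m t : ℝ) * s t)) * Ψ.ψ X) →
      periodicGroundStateEnergy v N L + e ≤ periodicEnergy v Ψ) :
    periodicGroundStateEnergy v N L + e ≤ momentumSectorEnergy v N L (latticeVec (2 * Real.pi / L) m) := by
  rw [le_momentumSectorEnergy_iff]
  intro Ψ hΨ
  refine h Ψ fun X s => ?_
  have := hΨ s X
  rw [sum_latticeVec_mul] at this
  exact this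

/-- **H — the floor-sourced `H₋₁` datum (route bypass), from the registered bricks B1, B4**: `LandauSectorBound`
(stmt-9091, BY NAME) gives, on the infrared window `|p| ≤ M₀√(ρa)`, for every real non-negative translation-invariant
exact minimiser `Θ` of the periodic `N`-body energy (N large, density window `ρ/2 ≤ N/L³ ≤ 2ρ`):
`hMinusOneSqW L |Θ| (∑ⱼ cos(p·xⱼ)) ≤ N/(2θ²ρa)` — the `H₋₁` input of CorrectorClosure (stmt-12058) in the shape of
stmt-12060's conclusion, the energy currency never touched (adapted from the planner's `floorSourced_hMinusOne`). -/
theorem floorSourced_hMinusOne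
    (hLandau : _root_.Summit.AtomisticToContinuum.BoseEinsteinCondensation.Theses.BECSectorPoincareTwoScale.LandauSectorBound) :
    ∀ v : ℝ → ℝ≥0∞, IsRepulsiveFiniteRange v → ∀ M₀ : ℝ, 0 < M₀ → ∃ θ : ℝ, 0 < θ ∧ ∃ ρ₀ : ℝ, 0 < ρ₀ ∧
      ∀ ρ : ℝ, 0 < ρ → ρ < ρ₀ → ∀ᶠ N : ℕ in Filter.atTop, ∀ L : ℝ, 0 < L →
        ρ / 2 ≤ (N : ℝ) / L ^ 3 → (N : ℝ) / L ^ 3 ≤ 2 * ρ → ∀ m : Fin 3 → ℤ, m ≠ 0 →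
          2 * Real.pi / L * ‖(WithLp.toLp 2 fun t => (m t : ℝ) : EuclideanSpace ℝ (Fin 3))‖ ≤
              M₀ * Real.sqrt (ρ * (scatteringLength v).toReal) →
          ∀ Θ : PeriodicTrialState N L, (∀ X, Θ.ψ X = (‖Θ.ψ X‖ : ℂ)) → HasTotalMomentum 0 Θ.ψ →
            periodicEnergy v Θ = periodicGroundStateEnergy v N L → periodicEnergy v Θ ≠ ⊤ →
            hMinusOneSqW L (fun X => ‖Θ.ψ X‖)
                (fun X => ∑ j, Real.cos (2 * Real.pi / L * ∑ i, (m i : ℝ) * X j i)) ≤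
              ENNReal.ofReal (N / (2 * θ ^ 2 * (ρ * (scatteringLength v).toReal))) := by
  intro v hv M₀ hM₀
  obtain ⟨θ, hθ, ρ₀, hρ₀, hfloor⟩ := hLandau v hv M₀ hM₀
  refine ⟨θ, hθ, ρ₀, hρ₀, fun ρ hρ hρρ₀ => ?_⟩
  filter_upwards [hfloor ρ hρ hρρ₀] with N hN
  intro L hL hw₁ hw₂ m hm hkM Θ hreal htr hmin hfin
  set a : ℝ := (scatteringLength v).toReal with ha_def
  set kk : ℝ := 2 * Real.pi / L * ‖(WithLp.toLp 2 fun t => (m t : ℝ) : EuclideanSpace ℝ (Fin 3))‖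
    with hkk_def
  set ω : ℝ := θ * Real.sqrt (ρ * a) * kk with hω_def
  have hlit := hN L hL hw₁ hw₂ m hm hkM
  have hm' : (WithLp.toLp 2 fun t => (m t : ℝ) : EuclideanSpace ℝ (Fin 3)) ≠ 0 := by
    intro h0
    apply hm
    funext t
    have := congrArg (fun x : EuclideanSpace ℝ (Fin 3) => x t) h0
    simpa using this
  have hkkpos : 0 < kk := by
    rw [hkk_def]
    exact mul_pos (by positivity) (norm_pos_iff.mpr hm')
  have hsqrtpos : 0 < Real.sqrt (ρ * a) := by
    by_contra hle
    push Not at hle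
    have : kk ≤ 0 := hkM.trans (by nlinarith [hM₀.le])
    linarith
  have hρa : 0 < ρ * a := Real.sqrt_pos.mp hsqrtpos
  have hωpos : 0 < ω := by rw [hω_def]; positivity
  have hsec : periodicGroundStateEnergy v N L + ENNReal.ofReal ω ≤
      momentumSectorEnergy v N L (latticeVec (2 * Real.pi / L) m) :=
    momentumSectorEnergy_floor_of_literal v N L m (ENNReal.ofReal ω) hlit
  have hP : ENNReal.ofReal ω ≤ sectorPoincareConstant L Θ.ψ (latticeVec (2 * Real.pi / L) m) :=
    energyFloorToPoincareFloor_holds v N L hL Θ hreal htr hmin hfin m ω hωpos.le hsec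
  have hB1 := sectorFloorToHMinusOne_holds N L hL m Θ htr ω hωpos hP
  refine hB1.trans (le_of_eq ?_)
  have hnorm : ‖(WithLp.toLp 2 fun t => (m t : ℝ) : EuclideanSpace ℝ (Fin 3))‖ ^ 2 =
      ∑ i, (m i : ℝ) ^ 2 := by
    rw [EuclideanSpace.norm_eq, Real.sq_sqrt (Finset.sum_nonneg fun i _ => by positivity)]
    exact Finset.sum_congr rfl fun i _ => by simp [sq_abs]
  have hpsq : (2 * Real.pi / L) ^ 2 * ∑ i, (m i : ℝ) ^ 2 = kk ^ 2 := by
    rw [hkk_def, mul_pow, hnorm]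
  have hω2 : ω ^ 2 = θ ^ 2 * (ρ * a) * kk ^ 2 := by
    rw [hω_def, mul_pow, mul_pow, Real.sq_sqrt hρa.le]
  congr 1
  rw [hpsq, hω2]
  have hkk0 : kk ^ 2 ≠ 0 := pow_ne_zero 2 hkkpos.ne'
  have hθ0 : θ ^ 2 ≠ 0 := pow_ne_zero 2 hθ.ne'
  have hρa0 : ρ * a ≠ 0 := hρa.ne'
  field_simp

/-- **K — the kill-edge, from the registered bricks B2, B3**: `StaticResponseBound` (BY NAME) gives, for every exact real
non-negative translation-invariant minimiser `Θ` at `L = (N/ρ)^{1/3}`, `ρ < ρ₀(v)`, `N ≥ 1`, `k ≠ 0`: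
`(∫ V_p² |Θ|²)² ≤ 4 (CN/max(ρa,|p|²)) · N|p|²/8`, i.e. with `∫V_p²|Θ|² = N S(p)/2`:
`S(p) ≤ √(2C) |p| / √max(ρa,|p|²)` — hyperuniformity of torus minimisers for ALL `N` is NECESSARY for the crux (refute it at one
admissible `(ρ, N, k)` for every `C` and the crux dies on both routes).  Adapted from the planner's
`hyperuniformity_of_staticResponseBound`. -/
theorem hyperuniformity_of_staticResponseBound
    (hS : _root_.Summit.AtomisticToContinuum.BoseEinsteinCondensation.Theses.BECInsertionCorrector.StaticResponseBound) :
    ∀ v : ℝ → ℝ≥0∞, IsRepulsiveFiniteRange v → ∃ ρ₀ : ℝ, 0 < ρ₀ ∧ ∃ C : ℝ, 0 < C ∧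
      ∀ ρ : ℝ, 0 < ρ → ρ < ρ₀ → ∀ N : ℕ, 0 < N → ∀ k : Fin 3 → ℤ, k ≠ 0 →
        ∀ Θ : PeriodicTrialState N (sideLength ρ N), (∀ X, Θ.ψ X = (‖Θ.ψ X‖ : ℂ)) →
          HasTotalMomentum 0 Θ.ψ →
          periodicEnergy v Θ = periodicGroundStateEnergy v N (sideLength ρ N) →
          periodicEnergy v Θ ≠ ⊤ →
          (∫ X in cellN N (sideLength ρ N),
              (∑ j, Real.cos (2 * Real.pi / sideLength ρ N * ∑ i, (k i : ℝ) * X j i)) ^ 2 *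
                ‖Θ.ψ X‖ ^ 2) ^ 2 ≤
            4 * (C * N / max (ρ * (scatteringLength v).toReal) (psq (sideLength ρ N) k)) *
              (N * psq (sideLength ρ N) k / 8) := by
  intro v hv
  obtain ⟨ρ₀, hρ₀, C, hC, hbody⟩ := hS v hv
  refine ⟨ρ₀, hρ₀, C, hC, ?_⟩
  intro ρ hρ hρρ₀ N hN k hk Θ hreal htr hmin hfin
  have hL : 0 < sideLength ρ N := sideLength_pos' hρ hN
  have hM0 : 0 ≤ max (ρ * (scatteringLength v).toReal) (psq (sideLength ρ N) k) :=
    le_max_of_le_right (by unfold psq; positivity)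
  have hB0 : 0 ≤ C * N / max (ρ * (scatteringLength v).toReal) (psq (sideLength ρ N) k) :=
    div_nonneg (by positivity) hM0
  have hbody' : ∀ (t : ℝ) (Ψ : PeriodicTrialState N (sideLength ρ N)), periodicEnergy v Ψ ≠ ⊤ →
      (periodicGroundStateEnergy v N (sideLength ρ N)).toReal -
          C * N / max (ρ * (scatteringLength v).toReal) (psq (sideLength ρ N) k) * t ^ 2 ≤
        (periodicEnergy v Ψ).toReal +
          t * ∫ X in cellN N (sideLength ρ N),
            (∑ j, Real.cos (2 * Real.pi / sideLength ρ N * ∑ i, (k i : ℝ) * X j i)) *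
              ‖Ψ.ψ X‖ ^ 2 := by
    intro t Ψ hΨ
    have h := hbody ρ hρ hρρ₀ N k hk t Ψ hΨ
    have hrw : C * t ^ 2 * (N : ℝ) / max (ρ * (scatteringLength v).toReal)
        ((2 * Real.pi / sideLength ρ N) ^ 2 * ∑ i, (k i : ℝ) ^ 2) =
        C * N / max (ρ * (scatteringLength v).toReal) (psq (sideLength ρ N) k) * t ^ 2 := by
      rw [psq]
      ring
    rw [hrw] at h
    exact h
  have hdisc := groundStateDiscriminant_holds v N (sideLength ρ N) hL Θ hreal hmin hfin k _ hB0 hbody'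
  exact responseToHyperuniformity_holds N (sideLength ρ N) hL k hk Θ htr _ (mul_nonneg (by norm_num) hB0) hdisc

/-- **SectorFloor ⟹ hyperuniformity of exact minimisers, ALL `N`** (Feynman–Bijl; the landed calibration
`hyperuniformity_of_sectorFloor`, p101763, applied to the registered core B): at every window mode the exact real
translation-invariant ground states have `N S_N(p) ≤ N|p|/(θ_L√(ρa))` — the 9093-body with `C = 1/θ_L` for all `N ≥ 1`.
So core B alone already sources every LINEAR-response datum of the IR window (floor ⇒ H₋₁ datum by H, floor ⇒ S(p) ≤ C|p|ξ here);
ECSF is needed only for the all-states (non-linear) upgrade. -/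
theorem hyperuniformity_of_B :
    ∀ v : ℝ → ℝ≥0∞, IsRepulsiveFiniteRange v → ∀ M₀ : ℝ, 0 < M₀ →
      ∃ θL : ℝ, 0 < θL ∧ ∃ ρ₀ : ℝ, 0 < ρ₀ ∧ ∀ ρ : ℝ, 0 < ρ → ρ < ρ₀ → ∀ N : ℕ, 0 < N →
        ∀ m : Fin 3 → ℤ, m ≠ 0 →
          Real.sqrt (psq (sideLength ρ N) m) ≤ M₀ * Real.sqrt (ρ * (scatteringLength v).toReal) →
          ∀ Θ : PeriodicTrialState N (sideLength ρ N), (∀ X, Θ.ψ X = (‖Θ.ψ X‖ : ℂ)) →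
            HasTotalMomentum 0 Θ.ψ →
            periodicEnergy v Θ = periodicGroundStateEnergy v N (sideLength ρ N) →
            periodicEnergy v Θ ≠ ⊤ →
            (⨅ c : ℂ, ∫⁻ X in cellN N (sideLength ρ N),
                (‖(∑ j : Fin N, Complex.exp (Complex.I *
                    ↑(2 * Real.pi / sideLength ρ N * ∑ t : Fin 3, (m t : ℝ) * X j t))) - c‖₊ : ℝ≥0∞) ^ 2 *
                  (‖Θ.ψ X‖₊ : ℝ≥0∞) ^ 2) ≤
              ENNReal.ofReal (N * Real.sqrt (psq (sideLength ρ N) m) /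
                (θL * Real.sqrt (ρ * (scatteringLength v).toReal))) :=
  hyperuniformity_of_sectorFloor stub_sectorFloor

end

end Summit.AtomisticToContinuum.BoseEinsteinCondensation.Cruxes.StaticResponseBound.StableFractionSquareCompletion
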